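import Literature.MathematicalPhysics.QuantumFieldTheory.Balaban1983to89.B8Eq178Averages
import Literature.MathematicalPhysics.QuantumFieldTheory.Balaban1983to89.B8Eq1112Quotient
import Literature.MathematicalPhysics.QuantumFieldTheory.Balaban1983to89.B8Eq184Proof

/-!
# `Balaban1983to89.B8Restr129Inversion` — [Balaban1985RegularSpaces] (1.29)/(1.78): (1.29) AT `k` LEVELS FOR `u⁻¹` IFF FOR `u`, HENCE
# FOR THE COMPOSITE `u₁·u′` IFF FOR `u′⁻¹·u₁⁻¹` — the ORDER of «u = u′u₁» (p. 94) reconciled WITHOUT conjugation, from the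
# inverse-commutation of the averaging operation (78)–(80) of [3] (`B8Eq1112Quotient.uavg_inv`, cell `lit-balaban` p05)

statement-level skeleton of published theorems with citation tags; proofs where landed; nothing here is a claim about the
Yang–Mills mass gap

T. Bałaban, *Spaces of regular gauge field configurations on a lattice and gauge fixing conditions*, Commun. Math. Phys. **99**
(1985) 75–102 `[Balaban1985RegularSpaces]` ("B8"), (1.29) p. 81, (1.78) p. 90, p. 94 («The composition u = u′u₁ of these two gauge
transformations is the transformation we are looking for»); [3] = T. Bałaban, *Averaging operations for lattice gauge theories*,
CMP **98** (1985) 17–51 `[Balaban1985Averaging]`, (78)–(80) p. 30, (167) p. 44.  STATUS: published, refereed.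

CITATION HEADER (lean-in-tree rule).  Cell `pub-ymgap` (YM Track A, DAG node N05 = [B8], HUMAN RULING D-0062), seat `pub-ymgap-dag-n04-b`
gen 2; the ORDER SEAM of REBALANCE №41 (owner's ruling (a), n05-a [WORD-41-ORDER]).  In the tree the moving-frame action
`B7Eq92Concrete.mgauge` is a LEFT action (`mgauge_mgauge`), so the Theorem-4 driver (`B8Thm4SupportLocal`) asks (1.29) for the pointwise
product `u₁ * v` after the Prop.-5 step, while the (1.78)/(1.79)/Sect. E chain (`B8Eq178Averages.restr129_mul_iff_cond179`,
`B7Prop10General.utilG`) types print's word «u′u₁» literally as the pointwise `u' * u₁`.  WHAT IS REPRODUCED: since the averaging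
operation (78)–(80) of [3] commutes with inversion EXACTLY inside the ball of the series logarithm (`B8Eq1112Quotient.uavg_inv`, the tacit
step of p. 95 / [3] p. 45 typed by cell `lit-balaban` p05), (1.29) at `k` levels holds for `u⁻¹` iff for `u`, and therefore for the
driver's `u₁ * u′` iff for `u′⁻¹ * u₁⁻¹ = (u₁ * u′)⁻¹` — the (1.78)-chain's ORDER for the pair `(u′⁻¹, u₁⁻¹) = (e^{−iλ′}, u₁⁻¹)`, which
satisfies the same regularity conditions (166)/(167), (176)/(177) as `(u′, u₁)` (`B8Eq1112Quotient.inLambda_inv`).  No conjugation of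
the parameter `λ′`, no change of background.  Kind «kernel-checked proof», no `def`, no `… : Prop` fact.

## WHAT IS CERTIFIED HERE (kernel; axioms `propext` / `Classical.choice` / `Quot.sound`)

* `restr129_inv_iff` — for `u` with (167) at constant `β`, `βLᵏη < ½` (`L ≥ 1`, `η ≥ 0`): `Restr129 L k Λ U₀ u⁻¹ ↔ Restr129 L k Λ U₀ u`;
* `restr129_mul_iff_inv_mul` — for `u′⁻¹ * u₁⁻¹` with (167) at constant `β`, `βLᵏη < ½`:
  `Restr129 L k Λ U₀ (u₁ * u′) ↔ Restr129 L k Λ U₀ (u′⁻¹ * u₁⁻¹)`;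
* `restr129_mul_of_cond179_inv` — the (1.78)-chain read for the inverse pair: if `u₁⁻¹` satisfies (1.29), the averages `ũ` of the pair
  `(u′⁻¹, u₁⁻¹)` stay in the domain of the logarithm, the product `u′⁻¹u₁⁻¹` satisfies (167) as above, and (1.79) `Cond179` holds for
  `(u′⁻¹, u₁⁻¹)`, then the driver's composite `u₁ * u′` satisfies (1.29).

HONEST SCOPE.  Group algebra on top of `uavg_inv`; nothing of Proposition 5 / Sect. E is proved here; which seat feeds `(e^{−iλ′}, u₁⁻¹)`
to the (1.78)-chain is the owner's call (n05-a); count-neutral; N05 NOT discharged; `T_η ↦ ℤᵈ`; nothing continuum / mass-gap / Clay.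
-/

noncomputable section

open NormedSpace

namespace Literature.MathematicalPhysics.QuantumFieldTheory.Balaban1983to89.B8Restr129Inversion

open MatrixLog B7Prop1Explicit B7Prop2Explicit B7Eq92Concrete B7Eq99Concrete B7Eq84Concrete
open B7Eq167Flat (Cond167)
open B7Eq78Linearization (Rbar zdBlocking)
open B8Eq119TwistedAxial (bgT Restr129)
open B8Eq178Averages (rbar_bgT_eq_uavg util178 Cond179 restr129_mul_iff_cond179)
open B8Eq1112Quotient (uavg_inv)
open B8Eq184Proof (gaugeExp)

-- `Site` alone could resolve to the torus sites of `Setup.lean`; re-export the `ℤ^d` sites of `B7Prop1Explicit`.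
export B7Prop1Explicit (Site)

variable {d : ℕ} {𝔸 : Type*} [NormedRing 𝔸] [NormedAlgebra ℂ 𝔸] [CompleteSpace 𝔸]
variable {L k : ℕ} {Λ : ℕ → Set (Site d)} {U₀ : Site d → Fin d → 𝔸ˣ} {β η : ℝ}

/-- **(1.29) at `k` levels for `u⁻¹` iff for `u`**: `\overline{R₀u⁻¹}ʲ = (\overline{R₀u}ʲ)⁻¹` (`B8Eq1112Quotient.uavg_inv`, inside the ball
of the logarithm: (167) for `u` at constant `β` with `βLᵏη < ½`), and a unit is `1` iff its inverse is.
[cite: Balaban1985RegularSpaces, (1.29) p.81; Balaban1985Averaging, (79)–(80) p.30, (167) p.44] -/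
theorem restr129_inv_iff {u : Site d → 𝔸ˣ} (h167 : Cond167 L U₀ u k β η) (hL : 1 ≤ L) (hη : 0 ≤ η) (hβ : 0 ≤ β)
    (hs : β * (L : ℝ) ^ k * η < 1 / 2) : Restr129 L k Λ U₀ u⁻¹ ↔ Restr129 L k Λ U₀ u := by
  unfold Restr129
  refine forall_congr' fun j => forall_congr' fun hj => forall_congr' fun y => forall_congr' fun _ => ?_
  rw [rbar_bgT_eq_uavg L U₀ u⁻¹ j, rbar_bgT_eq_uavg L U₀ u j]
  simp only [uavg_inv h167 hL hη hβ hs j hj, Pi.inv_apply, Units.val_eq_one, inv_eq_one]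

/-- **THE ORDER OF THE COMPOSITE: (1.29) for `u₁·u′` iff (1.29) for `u′⁻¹·u₁⁻¹`**, since `u₁u′ = (u′⁻¹u₁⁻¹)⁻¹`; the (167)-smallness is
asked of the averages of the (1.78)-order product `u′⁻¹u₁⁻¹` ([3] Prop. 10 for the pair `(u′⁻¹, u₁⁻¹)` supplies it).  The Theorem-4
driver's `Restr129 … (u₁ * v)` is thereby the (1.78)/(1.79)/Sect. E chain's `Restr129 … (v⁻¹ * u₁⁻¹)`, `v⁻¹ = e^{−iλ}`, with NO
conjugation of the parameter. [cite: Balaban1985RegularSpaces, (1.29) p.81, (1.78) p.90, p.94 («u = u′u₁»)] -/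
theorem restr129_mul_iff_inv_mul {u₁ u' : Site d → 𝔸ˣ} (h167 : Cond167 L U₀ (u'⁻¹ * u₁⁻¹) k β η) (hL : 1 ≤ L) (hη : 0 ≤ η)
    (hβ : 0 ≤ β) (hs : β * (L : ℝ) ^ k * η < 1 / 2) :
    Restr129 L k Λ U₀ (u₁ * u') ↔ Restr129 L k Λ U₀ (u'⁻¹ * u₁⁻¹) := by
  have h : u₁ * u' = (u'⁻¹ * u₁⁻¹)⁻¹ := by rw [mul_inv_rev, inv_inv, inv_inv]
  rw [h]
  exact restr129_inv_iff h167 hL hη hβ hs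

/-- **The (1.78)-chain read for the inverse pair lands in the driver's order.**  If `u₁⁻¹` satisfies (1.29) at `k` levels, the averages
`ũʲ` of the pair `(u′⁻¹, u₁⁻¹)` stay in the domain of the logarithm on `𝔅_k` (`‖ũʲ − 1‖ < 1`, [3] (204)), the product `u′⁻¹u₁⁻¹`
satisfies (167) at constant `β` with `βLᵏη < ½`, and (1.79) holds for `(u′⁻¹, u₁⁻¹)` — «`Q′(u₁⁻¹, −λ′) = 0` on `𝔅_k`» in the currency
`Cond179` — then the composite `u₁·u′` of the Theorem-4 driver satisfies (1.29) at `k` levels.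
[cite: Balaban1985RegularSpaces, (1.78)–(1.79) p.90, (1.29) p.81, p.94] -/
theorem restr129_mul_of_cond179_inv [NormOneClass 𝔸] {u₁ u' : Site d → 𝔸ˣ} (h₁ : Restr129 L k Λ U₀ u₁⁻¹)
    (hdom : ∀ j, j ≤ k → ∀ y ∈ Λ j, ‖util178 L U₀ u'⁻¹ u₁⁻¹ j y - 1‖ < 1)
    (h167 : Cond167 L U₀ (u'⁻¹ * u₁⁻¹) k β η) (hL : 1 ≤ L) (hη : 0 ≤ η) (hβ : 0 ≤ β) (hs : β * (L : ℝ) ^ k * η < 1 / 2)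
    (h179 : Cond179 L k Λ U₀ u'⁻¹ u₁⁻¹) : Restr129 L k Λ U₀ (u₁ * u') :=
  (restr129_mul_iff_inv_mul h167 hL hη hβ hs).2 ((restr129_mul_iff_cond179 h₁ hdom).2 h179)

#print axioms restr129_mul_iff_inv_mul
#print axioms restr129_mul_of_cond179_inv


/-! ## §2 (v1.1) The inverse of `e^{iλ}` is `e^{−iλ}`; the (1.78)-chain for `(e^{−iλ}, u₁⁻¹)` lands (1.29) for `u₁·e^{iλ}` -/

/-- `(e^{iλ})⁻¹ = e^{i(−λ)}` pointwise (`gaugeExp`, `expUnit (I•λ)`): the inverse factor of route (a″) is again a gauge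
exponential, at the parameter `−λ` (same modulus (1.108), same self-adjointness). [cite: Balaban1985RegularSpaces, (1.107) p.94] -/
theorem gaugeExp_inv_eq_neg (lam : Site d → 𝔸) : (gaugeExp lam)⁻¹ = gaugeExp (-lam) := by
  funext x
  simp only [Pi.inv_apply, gaugeExp, Pi.neg_apply, smul_neg, val_inv_expUnit]

/-- **Route (a″), plug-in form.**  If `u₁⁻¹` satisfies (1.29) at `k` levels (equivalently `u₁`, `restr129_inv_iff`), the averages `ũʲ` of the
pair `(e^{−iλ}, u₁⁻¹)` stay in the domain of the logarithm on `𝔅_k`, the product `e^{−iλ}u₁⁻¹` satisfies (167) at constant `β` with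
`βLᵏη < ½`, and (1.79) `Cond179` holds for the pair `(e^{−iλ}, u₁⁻¹)` — the Sect.-E clause of the Prop.-5 fixed point READ AT `(−λ, u₁⁻¹)` —
then the Theorem-4 driver's composite `u₁·e^{iλ}` satisfies (1.29) at `k` levels: the last clause of the plain-currency fixed point `HFP` of
`B8Prop5KLevelLetters.hP5_step_of_HFP`, with NO conjugation of `λ`. [cite: Balaban1985RegularSpaces, (1.78)–(1.79) p.90, (1.107) p.94, (1.29) p.81] -/
theorem restr129_mul_gaugeExp_of_cond179_neg [NormOneClass 𝔸] {u₁ : Site d → 𝔸ˣ} {lam : Site d → 𝔸}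
    (h₁ : Restr129 L k Λ U₀ u₁⁻¹)
    (hdom : ∀ j, j ≤ k → ∀ y ∈ Λ j, ‖util178 L U₀ (gaugeExp (-lam)) u₁⁻¹ j y - 1‖ < 1)
    (h167 : Cond167 L U₀ (gaugeExp (-lam) * u₁⁻¹) k β η) (hL : 1 ≤ L) (hη : 0 ≤ η) (hβ : 0 ≤ β)
    (hs : β * (L : ℝ) ^ k * η < 1 / 2) (h179 : Cond179 L k Λ U₀ (gaugeExp (-lam)) u₁⁻¹) :
    Restr129 L k Λ U₀ (u₁ * gaugeExp lam) := by
  have h := restr129_mul_of_cond179_inv (u' := gaugeExp lam) h₁ (by rwa [gaugeExp_inv_eq_neg])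
    (by rwa [gaugeExp_inv_eq_neg]) hL hη hβ hs (by rwa [gaugeExp_inv_eq_neg])
  exact h

#print axioms restr129_mul_gaugeExp_of_cond179_neg

end Literature.MathematicalPhysics.QuantumFieldTheory.Balaban1983to89.B8Restr129Inversion

end
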